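/-
Copyright (c) 2026. All rights reserved.
Released under Apache 2.0 license as described in the file LICENSE.
Authors: abc-iut cell — seat abc-iut-w4-d104 (gen 2): proof-only addendum to
`HolomorphicCoresGermConjugation.lean` — the multiplier of an `𝒜_p`-germ under an ANTI-holomorphic change of
coordinates is the complex CONJUGATE multiplier ([AbsTopIII] Cor 2.7 (e) functoriality along RC-holomorphic
morphisms; input for GAP G-w5d226-1, anti-holomorphic case).
-/
import Literature.AnabelianGeometry.AbsoluteAnabelian.HolomorphicCoresGermConjugation
import HarnessLib

/-!
# [AbsTopIII] Cor 2.7 (e) along anti-holomorphic maps: multipliers go to their conjugates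

S. Mochizuki, *Topics in absolute anabelian geometry III* (bib key `MochizukiAbsTopIII2015`): morphisms of
Aut-holomorphic spaces of Riemann surfaces are the RC-HOLOMORPHIC étale maps — "either holomorphic or
anti-holomorphic at each point" (Def 2.1 (ii) p.51, Cor 2.3 (i) p.53) — and Cor 2.7 (e) (p.60) asserts the
functoriality of `𝒜_p` (with its "topological field structure on `𝒜_p ∪ {0}`") along finite étale morphisms.

`HolomorphicCoresGermConjugation.lean` (this seat, p420903) settled the HOLOMORPHIC case at the germ model:
the multiplier `c` of the affine representative `z ↦ p + c (z − p)` is a conjugation invariant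
(`hasDerivAt_conj_mulAffine`), so the induced map `𝒜_p ⥲ 𝒜_{φ p}` is "same multiplier".  This file adds the
ANTI-HOLOMORPHIC case, the `TODO(general form)` recorded by abc-iut-L4-t14 (04:25Z) for the geometric
instance of G-w5d226-1: an anti-holomorphic local isomorphism is `φ = h ∘ conj` with `h` holomorphic, and

* `conj_mulAffine_conj` — `conj ∘ (z ↦ p + c (z − p)) ∘ conj = (w ↦ p̄ + c̄ (w − p̄))` EXACTLY (an affine germ
  again, with conjugate multiplier);
* `hasDerivAt_antihol_conj_mulAffine` — conjugating the affine representative of multiplier `c` by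
  `φ = h ∘ conj` (local inverse `conj ∘ k`, `k` a local inverse of `h`) gives a map with complex derivative
  `c̄` at `q = φ p`: along an anti-holomorphic structure-morphism the induced field isomorphism
  `𝒜_𝕏 ∪ {0} ≅ ℂ → ℂ ≅ 𝒜_𝕐 ∪ {0}` is COMPLEX CONJUGATION on multipliers (as it must be: it is an isomorphism
  of topological fields `ℂ ⥲ ℂ` other than the identity).

Refereed pre-IUT material ([AbsTopIII] §2); nothing here bears on the disputed [IUTchIII] Cor. 3.12;
typed ≠ endorsed.  No definitions.
-/

namespace Literature.AnabelianGeometry.AbsoluteAnabelian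

open _root_.Complex _root_.Set _root_.Topology _root_.Filter _root_.Metric
open scoped ComplexConjugate

noncomputable section

/-- Conjugating the affine representative `z ↦ p + c (z − p)` by complex conjugation gives the affine
representative at `p̄` with the CONJUGATE multiplier `c̄` — on the nose.
[cite: MochizukiAbsTopIII2015, Corollary 2.7 (e) p.60] -/
theorem conj_mulAffine_conj (p c : ℂ) :
    (conj ∘ (fun z => p + c * (z - p)) ∘ conj : ℂ → ℂ) = fun w => conj p + conj c * (w - conj p) := by
  funext w
  simp only [Function.comp_apply, map_add, map_mul, map_sub, Complex.conj_conj]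

/-- The affine representative with conjugate multiplier, as the conjugate of the original one: the two
germ groups `𝒜_p` and `𝒜_{p̄}` correspond under `z ↦ z̄` by `c ↦ c̄` on multipliers.
[cite: MochizukiAbsTopIII2015, Corollary 2.7 (e) p.60] -/
theorem hasDerivAt_conj_mulAffine_conj (p c q : ℂ) :
    HasDerivAt (conj ∘ (fun z => p + c * (z - p)) ∘ conj : ℂ → ℂ) (conj c) q := by
  rw [conj_mulAffine_conj]
  exact hasDerivAt_mulAffine (conj p) (conj c) q

/-- **Cor 2.7 (e) along an ANTI-holomorphic local isomorphism, at the germ model**: write the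
anti-holomorphic map as `φ = h ∘ conj` with `h` complex-differentiable at `p̄` with derivative `d ≠ 0`, and
let `k` be a local inverse branch of `h` at `q` (`k q = p̄`, derivative `d⁻¹`), so that `conj ∘ k` inverts
`φ`.  Then the conjugate `φ ∘ (z ↦ p + c (z − p)) ∘ (conj ∘ k)` of the affine representative of multiplier `c`
has complex derivative `c̄` at `q`: the induced map on multipliers is COMPLEX CONJUGATION.
[cite: MochizukiAbsTopIII2015, Corollary 2.7 (e) p.60] -/
theorem hasDerivAt_antihol_conj_mulAffine {h k : ℂ → ℂ} {p q d : ℂ} (c : ℂ)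
    (hh : HasDerivAt h d (conj p)) (hk : HasDerivAt k d⁻¹ q) (hkq : k q = conj p) (hd : d ≠ 0) :
    HasDerivAt ((h ∘ conj) ∘ (fun z => p + c * (z - p)) ∘ (conj ∘ k)) (conj c) q := by
  have hrw : ((h ∘ conj) ∘ (fun z => p + c * (z - p)) ∘ (conj ∘ k) : ℂ → ℂ) =
      h ∘ (fun w => conj p + conj c * (w - conj p)) ∘ k := by
    rw [← conj_mulAffine_conj]
    rfl
  rw [hrw]
  exact hasDerivAt_conj_mulAffine (conj c) hh hk hkq hd

/-- The two cases side by side: along a HOLOMORPHIC local isomorphism the multiplier is preserved, along an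
ANTI-holomorphic one it is conjugated — so the induced map `𝒜_p ∪ {0} → 𝒜_{φ p} ∪ {0}`, read on multipliers,
is one of the two continuous field automorphisms of `ℂ` (identity / conjugation), as an "isomorphism of
topological fields" must be. [cite: MochizukiAbsTopIII2015, Corollary 2.7 (e) p.60] -/
theorem deriv_conj_mulAffine_hol_antihol {φ ψ h k : ℂ → ℂ} {p q q' d d' : ℂ} (c : ℂ)
    (hφ : HasDerivAt φ d p) (hψ : HasDerivAt ψ d⁻¹ q) (hψq : ψ q = p) (hd : d ≠ 0)
    (hh : HasDerivAt h d' (conj p)) (hk : HasDerivAt k d'⁻¹ q') (hkq : k q' = conj p) (hd' : d' ≠ 0) :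
    deriv (φ ∘ (fun z => p + c * (z - p)) ∘ ψ) q = c ∧
      deriv ((h ∘ conj) ∘ (fun z => p + c * (z - p)) ∘ (conj ∘ k)) q' = conj c :=
  ⟨(hasDerivAt_conj_mulAffine c hφ hψ hψq hd).deriv,
    (hasDerivAt_antihol_conj_mulAffine c hh hk hkq hd').deriv⟩

end

end Literature.AnabelianGeometry.AbsoluteAnabelian
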